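import Literature.MathematicalPhysics.QuantumLattice.InfVolFermionState
import HarnessLib

/-!
# Rank-one operators between fermion states of a common particle-number parity are even

Topic `MathematicalPhysics/QuantumLattice` (CAR bookkeeping for Jordan–Wigner product states; consumer: the
plaquette-boson dictionary of the Hubbard summit, where the rank-one projections `|φ⟩⟨φ|` of plaquette ground
states must commute with the even operators of the OTHER plaquettes — graded locality needs `|φ⟩⟨φ|` to lie in
the EVEN CAR subalgebra). Everything is PROVED; no definition and no named fact is introduced:

* `single_mem_carEvenSubalgebra` — the matrix unit `|s⟩⟨t| = Matrix.single s t 1` of the finite Fock space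
  `Fock ι = (Finset ι → ℂ)` lies in the even CAR subalgebra `carEvenSubalgebra univ` (the subalgebra generated
  by the products of TWO Jordan–Wigner generators) whenever `#s + #t` is even: `|s⟩⟨t| = ± c†…c† |∅⟩⟨∅| c…c`
  is a word of even length times the (even) vacuum projection `∏ᵢ (1 − nᵢ)`; the proof grows `s` and `t` two
  orbitals at a time (`c†c†`, `cc` are even generators) from the two base cases `|∅⟩⟨∅|` and
  `|{i}⟩⟨{j}| = c†ᵢ cⱼ |{j}⟩⟨{j}|`;
* `vecMulVec_mem_carEvenSubalgebra` — hence `|φ⟩⟨φ'| ∈ carEvenSubalgebra univ` for an `a`-particle `φ` and a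
  `b`-particle `φ'` with `a + b` even; in particular the projection `|φ⟩⟨φ|` of a vector of definite
  particle number is even (`vecMulVec_self_mem_carEvenSubalgebra`).

Reference: O. Bratteli, D. W. Robinson, *Operator Algebras and Quantum Statistical Mechanics II* (1997),
§5.2.2 (the even subalgebra of the CAR algebra; Thm. 5.2.5) [cite: BratteliRobinsonII1997, §5.2.2]. All
statements are [folklore].
-/

namespace Literature.MathematicalPhysics.QuantumLattice

open Matrix Finset HubbardWave0

section RankOneParity

variable {ι : Type*} [LinearOrder ι] [Fintype ι]

/-! ### Even diagonal operators: vacancy indicators -/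

/-- The vacancy indicators `Q_T = diag [T ∩ s = ∅] = ∏_{i ∈ T} (1 - nᵢ)` are even. [folklore] -/
theorem diagonal_disjoint_mem_carEvenSubalgebra (T : Finset ι) :
    Matrix.diagonal (fun s : Finset ι => if Disjoint T s then (1 : ℂ) else 0) ∈
      carEvenSubalgebra (Finset.univ : Finset ι) := by
  induction T using Finset.induction_on with
  | empty =>
    have h : (fun s : Finset ι => if Disjoint (∅ : Finset ι) s then (1 : ℂ) else 0) = fun _ => 1 :=
      funext fun s => if_pos (Finset.disjoint_empty_left s)
    rw [h, Matrix.diagonal_one]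
    exact Subalgebra.one_mem _
  | insert i T hi ih =>
    have h : Matrix.diagonal (fun s : Finset ι => if Disjoint (insert i T) s then (1 : ℂ) else 0) =
        Matrix.diagonal (fun s : Finset ι => if Disjoint T s then (1 : ℂ) else 0) *
          (1 - creation i * annihilation i) := by
      have hn : creation i * annihilation i = numberAt i := rfl
      rw [hn, numberAt_eq_diagonal, ← Matrix.diagonal_one, Matrix.diagonal_sub,
        Matrix.diagonal_mul_diagonal]
      congr 1
      funext s
      by_cases his : i ∈ s <;> by_cases hT : Disjoint T s <;>
        simp [Finset.disjoint_insert_left, his, hT]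
    rw [h]
    exact Subalgebra.mul_mem _ ih (Subalgebra.sub_mem _ (Subalgebra.one_mem _)
      (creation_mul_annihilation_mem_carEvenSubalgebra (Finset.mem_univ i) (Finset.mem_univ i)))

/-- The vacuum projection `|∅⟩⟨∅| = ∏ᵢ (1 - nᵢ)` is even. [folklore] -/
theorem single_empty_empty_mem_carEvenSubalgebra :
    Matrix.single (∅ : Finset ι) ∅ (1 : ℂ) ∈ carEvenSubalgebra (Finset.univ : Finset ι) := by
  have h : Matrix.single (∅ : Finset ι) ∅ (1 : ℂ) =
      Matrix.diagonal (fun s : Finset ι => if Disjoint Finset.univ s then (1 : ℂ) else 0) := by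
    ext u v
    simp only [Matrix.single_apply, Matrix.diagonal_apply]
    by_cases huv : u = v
    · subst huv
      by_cases hu : u = ∅
      · subst hu
        rw [if_pos ⟨rfl, rfl⟩, if_pos rfl, if_pos (Finset.disjoint_empty_right _)]
      · rw [if_neg (fun h => hu h.1.symm), if_pos rfl, if_neg]
        intro hd
        obtain ⟨x, hx⟩ := Finset.nonempty_iff_ne_empty.2 hu
        exact Finset.disjoint_left.1 hd (Finset.mem_univ x) hx
    · rw [if_neg (fun h => huv (h.1.symm.trans h.2)), if_neg huv]
  rw [h]
  exact diagonal_disjoint_mem_carEvenSubalgebra Finset.univ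

/-- The one-orbital projection `|{j}⟩⟨{j}| = nⱼ ∏_{i ≠ j} (1 - nᵢ)` is even. [folklore] -/
theorem single_singleton_singleton_mem_carEvenSubalgebra (j : ι) :
    Matrix.single ({j} : Finset ι) {j} (1 : ℂ) ∈ carEvenSubalgebra (Finset.univ : Finset ι) := by
  have h : Matrix.single ({j} : Finset ι) {j} (1 : ℂ) =
      numberAt j * Matrix.diagonal (fun s : Finset ι => if Disjoint (Finset.univ.erase j) s then (1 : ℂ) else 0) := by
    rw [numberAt_eq_diagonal, Matrix.diagonal_mul_diagonal]
    ext u v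
    simp only [Matrix.single_apply, Matrix.diagonal_apply]
    by_cases huv : u = v
    · subst huv
      by_cases hu : u = {j}
      · subst hu
        rw [if_pos ⟨rfl, rfl⟩, if_pos rfl, if_pos (Finset.mem_singleton_self j), if_pos, one_mul]
        exact Finset.disjoint_singleton_right.2 (Finset.notMem_erase j _)
      · rw [if_neg (fun h => hu h.1.symm), if_pos rfl]
        by_cases hj : j ∈ u
        · rw [if_pos hj, one_mul, if_neg]
          intro hd
          apply hu
          refine Finset.eq_singleton_iff_unique_mem.2 ⟨hj, fun x hx => ?_⟩
          by_contra hxj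
          exact Finset.disjoint_left.1 hd (Finset.mem_erase.2 ⟨hxj, Finset.mem_univ x⟩) hx
        · rw [if_neg hj, zero_mul]
    · rw [if_neg (fun h => huv (h.1.symm.trans h.2)), if_neg huv]
  rw [h]
  exact Subalgebra.mul_mem _
    (creation_mul_annihilation_mem_carEvenSubalgebra (Finset.mem_univ j) (Finset.mem_univ j))
    (diagonal_disjoint_mem_carEvenSubalgebra _)

/-! ### The base case `|{i}⟩⟨{j}| = c†ᵢ cⱼ |{j}⟩⟨{j}|` -/

/-- The column `{j}` of `c†ᵢ cⱼ` is `e_{{i}}`: `⟨u| c†ᵢ cⱼ |{j}⟩ = [u = {i}]`. [folklore] -/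
theorem creation_mul_annihilation_apply_singleton (i j : ι) (u : Finset ι) :
    (creation i * annihilation j) u {j} = if u = {i} then (1 : ℂ) else 0 := by
  rw [Matrix.mul_apply, Finset.sum_eq_single (∅ : Finset ι)]
  · rw [annihilation_apply, if_pos ⟨Finset.notMem_empty j, rfl⟩, creation_apply]
    have h0 : jwSign j (∅ : Finset ι) = 1 := by simp [jwSign]
    have h0' : jwSign i (∅ : Finset ι) = 1 := by simp [jwSign]
    rw [h0, mul_one]
    by_cases hu : u = {i}
    · rw [if_pos ⟨Finset.notMem_empty i, hu⟩, if_pos hu, h0']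
    · rw [if_neg (fun h => hu h.2), if_neg hu]
  · intro w _ hw
    rw [annihilation_apply, if_neg, mul_zero]
    rintro ⟨hjw, hins⟩
    apply hw
    have : w ⊆ ({j} : Finset ι) := by rw [hins]; exact Finset.subset_insert j w
    rcases Finset.subset_singleton_iff.1 this with h | h
    · exact h
    · exact absurd (h ▸ Finset.mem_singleton_self j) hjw
  · exact fun h => absurd (Finset.mem_univ _) h

/-- `|{i}⟩⟨{j}| = c†ᵢ cⱼ |{j}⟩⟨{j}|`. [folklore] -/
theorem single_singleton_singleton_eq (i j : ι) :
    Matrix.single ({i} : Finset ι) ({j} : Finset ι) (1 : ℂ) =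
      creation i * annihilation j * Matrix.single ({j} : Finset ι) ({j} : Finset ι) (1 : ℂ) := by
  ext u v
  by_cases hv : v = {j}
  · subst hv
    rw [Matrix.mul_single_apply_same, mul_one, creation_mul_annihilation_apply_singleton, Matrix.single_apply]
    by_cases hu : u = {i}
    · subst hu; rw [if_pos ⟨rfl, rfl⟩, if_pos rfl]
    · rw [if_neg (fun h => hu h.1.symm), if_neg hu]
  · rw [Matrix.mul_single_apply_of_ne (hbj := hv), Matrix.single_apply, if_neg (fun h => hv h.2.symm)]

/-- The matrix unit `|{i}⟩⟨{j}|` is even. [folklore] -/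
theorem single_singleton_singleton_mem_carEvenSubalgebra' (i j : ι) :
    Matrix.single ({i} : Finset ι) ({j} : Finset ι) (1 : ℂ) ∈ carEvenSubalgebra (Finset.univ : Finset ι) := by
  rw [single_singleton_singleton_eq i j]
  exact Subalgebra.mul_mem _
    (creation_mul_annihilation_mem_carEvenSubalgebra (Finset.mem_univ i) (Finset.mem_univ j))
    (single_singleton_singleton_mem_carEvenSubalgebra j)

/-! ### Growing a matrix unit by two orbitals -/

/-- `|s ∪ {i}⟩⟨t| = σᵢ(s) c†ᵢ |s⟩⟨t|` for `i ∉ s`. [folklore] -/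
theorem single_insert_left_eq {i : ι} {s : Finset ι} (hi : i ∉ s) (t : Finset ι) :
    Matrix.single (insert i s) t (1 : ℂ) = jwSign i s • (creation i * Matrix.single s t 1) := by
  rw [creation_mul_single hi, smul_smul, jwSign_mul_self, one_smul]

/-- `|s⟩⟨t ∪ {j}| = σⱼ(t) |s⟩⟨t| cⱼ` for `j ∉ t`. [folklore] -/
theorem single_insert_right_eq (s : Finset ι) {j : ι} {t : Finset ι} (hj : j ∉ t) :
    Matrix.single s (insert j t) (1 : ℂ) = jwSign j t • (Matrix.single s t 1 * annihilation j) := by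
  rw [single_mul_annihilation s hj, smul_smul, jwSign_mul_self, one_smul]

/-- Two more creation operators keep evenness: `|s ∪ {i, i'}⟩⟨t| = ± c†ᵢ c†_{i'} |s⟩⟨t|`. [folklore] -/
theorem single_insert_insert_left_mem {i i' : ι} {s t : Finset ι} (hi : i ∉ insert i' s) (hi' : i' ∉ s)
    (h : Matrix.single s t (1 : ℂ) ∈ carEvenSubalgebra (Finset.univ : Finset ι)) :
    Matrix.single (insert i (insert i' s)) t (1 : ℂ) ∈ carEvenSubalgebra (Finset.univ : Finset ι) := by
  rw [single_insert_left_eq hi, single_insert_left_eq hi', mul_smul_comm, ← mul_assoc]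
  refine Subalgebra.smul_mem _ (Subalgebra.smul_mem _ (Subalgebra.mul_mem _ ?_ h) _) _
  exact Algebra.subset_adjoin ⟨(i, true), (i', true), Finset.mem_univ _, Finset.mem_univ _, rfl⟩

/-- Two more annihilation operators keep evenness: `|s⟩⟨t ∪ {j, j'}| = ± |s⟩⟨t| c_{j'} cⱼ`. [folklore] -/
theorem single_insert_insert_right_mem {j j' : ι} {s t : Finset ι} (hj : j ∉ insert j' t) (hj' : j' ∉ t)
    (h : Matrix.single s t (1 : ℂ) ∈ carEvenSubalgebra (Finset.univ : Finset ι)) :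
    Matrix.single s (insert j (insert j' t)) (1 : ℂ) ∈ carEvenSubalgebra (Finset.univ : Finset ι) := by
  rw [single_insert_right_eq s hj, single_insert_right_eq s hj', smul_mul_assoc, mul_assoc]
  refine Subalgebra.smul_mem _ (Subalgebra.smul_mem _ (Subalgebra.mul_mem _ h ?_) _) _
  exact Algebra.subset_adjoin ⟨(j', false), (j, false), Finset.mem_univ _, Finset.mem_univ _, rfl⟩

/-! ### Matrix units of even total degree are even -/

/-- **Matrix units of even total degree are even**: `|s⟩⟨t| ∈ carEvenSubalgebra univ` whenever `#s + #t`
is even (`|s⟩⟨t|` is `±` a word of `#s` creation and `#t` annihilation operators around the even vacuum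
projection). [cite: BratteliRobinsonII1997, §5.2.2] -/
theorem single_mem_carEvenSubalgebra :
    ∀ (n : ℕ) (s t : Finset ι), s.card + t.card = 2 * n →
      Matrix.single s t (1 : ℂ) ∈ carEvenSubalgebra (Finset.univ : Finset ι) := by
  intro n
  induction n with
  | zero =>
    intro s t hst
    have hs : s = ∅ := Finset.card_eq_zero.1 (by omega)
    have ht : t = ∅ := Finset.card_eq_zero.1 (by omega)
    subst hs; subst ht
    exact single_empty_empty_mem_carEvenSubalgebra
  | succ n ih =>
    intro s t hst
    by_cases hs2 : 2 ≤ s.card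
    · -- peel two orbitals off `s`
      obtain ⟨i, hi⟩ : s.Nonempty := Finset.card_pos.1 (by omega)
      have hcard1 : (s.erase i).card = s.card - 1 := Finset.card_erase_of_mem hi
      obtain ⟨i', hi'⟩ : (s.erase i).Nonempty := Finset.card_pos.1 (by omega)
      set s'' := (s.erase i).erase i' with hs''
      have hcard2 : s''.card = s.card - 2 := by
        rw [hs'', Finset.card_erase_of_mem hi', hcard1]; omega
      have hi's'' : i' ∉ s'' := Finset.notMem_erase i' _
      have his' : i ∉ insert i' s'' := by
        rw [Finset.mem_insert]
        rintro (h | h)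
        · exact (Finset.mem_erase.1 hi').1 h.symm
        · exact (Finset.mem_erase.1 ((Finset.mem_erase.1 h).2)).1 rfl
      have hs_eq : s = insert i (insert i' s'') := by
        rw [hs'', Finset.insert_erase hi', Finset.insert_erase hi]
      rw [hs_eq]
      exact single_insert_insert_left_mem his' hi's'' (ih s'' t (by omega))
    · by_cases ht2 : 2 ≤ t.card
      · -- peel two orbitals off `t`
        obtain ⟨j, hj⟩ : t.Nonempty := Finset.card_pos.1 (by omega)
        have hcard1 : (t.erase j).card = t.card - 1 := Finset.card_erase_of_mem hj
        obtain ⟨j', hj'⟩ : (t.erase j).Nonempty := Finset.card_pos.1 (by omega)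
        set t'' := (t.erase j).erase j' with ht''
        have hcard2 : t''.card = t.card - 2 := by
          rw [ht'', Finset.card_erase_of_mem hj', hcard1]; omega
        have hj't'' : j' ∉ t'' := Finset.notMem_erase j' _
        have hjt' : j ∉ insert j' t'' := by
          rw [Finset.mem_insert]
          rintro (h | h)
          · exact (Finset.mem_erase.1 hj').1 h.symm
          · exact (Finset.mem_erase.1 ((Finset.mem_erase.1 h).2)).1 rfl
        have ht_eq : t = insert j (insert j' t'') := by
          rw [ht'', Finset.insert_erase hj', Finset.insert_erase hj]
        rw [ht_eq]
        exact single_insert_insert_right_mem hjt' hj't'' (ih s t'' (by omega))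
      · -- both have one element
        have hs1 : s.card = 1 := by omega
        have ht1 : t.card = 1 := by omega
        obtain ⟨i, rfl⟩ := Finset.card_eq_one.1 hs1
        obtain ⟨j, rfl⟩ := Finset.card_eq_one.1 ht1
        exact single_singleton_singleton_mem_carEvenSubalgebra' i j

/-- Matrix units `|s⟩⟨t|` with `#s + #t` even are even (`Even` form). [cite: BratteliRobinsonII1997, §5.2.2] -/
theorem single_mem_carEvenSubalgebra_of_even {s t : Finset ι} (h : Even (s.card + t.card)) :
    Matrix.single s t (1 : ℂ) ∈ carEvenSubalgebra (Finset.univ : Finset ι) := by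
  obtain ⟨n, hn⟩ := h
  exact single_mem_carEvenSubalgebra n s t (by omega)

/-! ### Rank-one operators between vectors of definite particle numbers -/

/-- **Rank-one operators between states of a common particle-number parity are even**:
`|φ⟩⟨φ'| ∈ carEvenSubalgebra univ` for an `a`-particle `φ` and a `b`-particle `φ'` with `a + b` even.
[cite: BratteliRobinsonII1997, §5.2.2] -/
theorem vecMulVec_mem_carEvenSubalgebra {a b : ℕ} {φ φ' : Fock ι} (hφ : IsNParticle a φ)
    (hφ' : IsNParticle b φ') (hab : Even (a + b)) :
    vecMulVec φ (star φ') ∈ carEvenSubalgebra (Finset.univ : Finset ι) := by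
  rw [Matrix.matrix_eq_sum_single (vecMulVec φ (star φ'))]
  refine Subalgebra.sum_mem _ fun s _ => Subalgebra.sum_mem _ fun t _ => ?_
  have h : Matrix.single s t (vecMulVec φ (star φ') s t) =
      vecMulVec φ (star φ') s t • Matrix.single s t (1 : ℂ) := by
    rw [Matrix.smul_single, smul_eq_mul, mul_one]
  rw [h]
  by_cases hst : s.card = a ∧ t.card = b
  · refine Subalgebra.smul_mem _ (single_mem_carEvenSubalgebra_of_even ?_) _
    rw [hst.1, hst.2]; exact hab
  · have h0 : vecMulVec φ (star φ') s t = 0 := by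
      rw [vecMulVec_apply, Pi.star_apply]
      rcases not_and_or.1 hst with hs | ht
      · rw [hφ s hs, zero_mul]
      · rw [hφ' t ht, star_zero, mul_zero]
    rw [h0, zero_smul]
    exact Subalgebra.zero_mem _

/-- The projection `|φ⟩⟨φ|` onto a vector of definite particle number is even.
[cite: BratteliRobinsonII1997, §5.2.2] -/
theorem vecMulVec_self_mem_carEvenSubalgebra {a : ℕ} {φ : Fock ι} (hφ : IsNParticle a φ) :
    vecMulVec φ (star φ) ∈ carEvenSubalgebra (Finset.univ : Finset ι) :=
  vecMulVec_mem_carEvenSubalgebra hφ hφ ⟨a, rfl⟩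

end RankOneParity

end Literature.MathematicalPhysics.QuantumLattice
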